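import Summits.BirchSwinnertonDyer.BirchSwinnertonDyer.Theorems.GenusKolyvaginAtTwoPowDvdShaCardAtTwoRTBottomRungTransverseSocket
import Summits.BirchSwinnertonDyer.BirchSwinnertonDyer.Theorems.GenusKolyvaginAtTwoPowDvdShaCardAtTwoPosTTranspositionFrame
import HarnessLib

/-!
# Route `GenusKolyvaginAtTwo`, crux L⁺_T′ `PowDvdShaCardAtTwoPosT` (stmt-BirchSwinnertonDyer-25501), road (E4)⁺, socket hbot⁺ —
# THE (V44)-SOCKET `hTr` AT A TRANSPOSITION-DEEP OWN PRIME, SIGN-FREE IN `Δ` (the TOP LEAF of the bottom rung: gk2-p3 g24's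
# `TransverseValue.hTr_of_three_le` with `Δ < 0` / `FrobEqFrobInfty` / the complex conjugation `c₀` replaced by «the Frobenius itself is regular»)

Seat `bsd-line-gk2-p5` g32 (WIDTH-5 attach, cell `bsd-f1-sign2`), `--supports stmt-BirchSwinnertonDyer-25501` (helper; closes nothing).
THEOREMS ONLY (no definition, no named fact, no `sorry`).  BSD is NOT proved by any of this; neither is L⁺_T′ nor the socket hbot⁺.

WHAT (LEAD gk2-p1 g20 rulings R10′/R10″; gk2-p4 g24's bottom-rung port `…PosTBottomRung{Local,Auxiliary,AuxiliaryDeep}Transposition` quantifies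
the transversality of `2•Z` at a deep place over EVERY prime above it and EVERY Frobenius there, with no `c₀`).
**`hTr_of_three_le_transposition`** — for `K` imaginary quadratic with `d_K` odd `≠ −3` (ANY sign of `Δ`): for a ℚ-class `Z` over `E[4]`
descending the level-`4` Kolyvagin class `c₂(n′)` of a square-free product `n′` of Zhang–Kolyvagin primes of index `≥ 2` of TRANSPOSITION type
(«some arithmetic Frobenius above `q` moves a point of `E[2]`», gk2-p2 g22's clause), an own prime `ℓ ∣ n′` of index `≥ L ≥ 3`, ANY prime `𝔓`
above `ℓ` and ANY arithmetic Frobenius `F` at `𝔓`: **`[2•Z, F] = F•P₁ − P₁` for some `P₁ ∈ E[4]`**.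
HOW (gk2-p3 g24's proof with `c₀ := F`).  At a transposition-deep prime EVERY Frobenius `F` above `ℓ` is an involution of `E[4]` moving a point of
`E[2]` (gk2-p2 `frob_involutive_and_moves_twoTorsion_of_transposition`), hence regular: `E[4] = ℤP₀ ⊕ ℤ·FP₀` freely over `ℤ/4` (crux-23716 engine
`Engine.exists_regular_generator_of_smul_twoTorsion_ne`).  LEAD g18's reduction `RelaxedCount.exists_h1Eval_two_nsmul_eq_smul_sub_of_sq` is
generic in the involution (`c₀` is a name): `hTr` at `(Z, F)` ⟸ `2 • [Z, F·F] = 0` ⟸ `2 • [res_K Z, τ] = 0` for `τ ∈ Γ_K` over `F·F`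
(`SelmerDescent.sq_mem_range_absGaloisRestrict_of_sq_eq`; `τ` fixes `E_K[4]` since `F² = 1` on `E[4]`), and gk2-p3 g24's sign-free K-side theorem
`TransverseValue.h1Eval_kolyvaginClass_eq_zero_of_absGaloisRestrict_eq_sq` (Howard 2.7.3 at `τ_{F²}`) gives `[c₂(n′), τ] = 0` outright.
Statement = `hTr_of_three_le` with `(hΔ : W.Δ < 0)` DELETED, `FrobEqFrobInfty W K (2^2) q` (own primes) and `FrobEqFrobInfty W K (2^L) ℓ` ↦ the
transposition clause, and the quantifier `∀ F c₀, IsArithFrobAt F 𝔓 → IsComplexConjugation c₀ → (∀ P, F • P = c₀ • P) → …` ↦ `∀ F, IsArithFrobAt F 𝔓 → …`.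

References: [McCallumLMS1991] §4 Prop. 4.4 (1), §5 proof of Prop. 5.2 (13), Lemma 5.3; [Howard2004HeegnerKolyvagin] Lemma 2.7.3;
[GrossLMS1991] §3 (3.1)–(3.3), §9; [Kolyvagin1991MathAnn] Thm. 2.2.
-/

set_option autoImplicit false
-- the Theorems namespace of this sub repeats the summit name by design (D-0017 nested layout)
set_option linter.dupNamespace false

noncomputable section

open scoped Classical Pointwise

open WeierstrassCurve NumberField IsDedekindDomain Field
open Literature.NumberTheory.EllipticCurves Literature.NumberTheory.GaloisRepresentations
open Literature.NumberTheory.GaloisCohomology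
open Literature.NumberTheory.EllipticCurves.ModularForms
open Summit.BirchSwinnertonDyer.Rank1Residual
open Summit.BirchSwinnertonDyer.BirchSwinnertonDyer.Theses.GenusKolyvaginAtTwo (KolyvaginRelationAtTwo)

namespace Summit.BirchSwinnertonDyer.BirchSwinnertonDyer.Theorems.GenusExact.TransverseValue

section Socket

variable {K : Type} [Field K] [NumberField K] (W : WeierstrassCurve ℚ) [W.IsElliptic] [W.IsGloballyMinimal]
  [NeZero (W.conductorNorm ℤ)]

/-- **THE (V44)-SOCKET `hTr` OF THE BOTTOM RUNG AT A TRANSPOSITION-DEEP OWN PRIME, any sign of `Δ`** (gk2-p3 g24's `hTr_of_three_le` with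
`c₀ := F`): `K` imaginary quadratic with `d_K` odd `≠ −3`; for a ℚ-class `Z` over `E[4]` descending the level-`4` Kolyvagin class `c₂(n′)` of a
square-free product `n′` of transposition-type Zhang–Kolyvagin primes of index `≥ 2`, an own prime `ℓ ∣ n′` of index `≥ L ≥ 3`, any prime `𝔓`
above `ℓ` and any arithmetic Frobenius `F` at `𝔓`: `[2•Z, F] = F•P₁ − P₁` for some `P₁`.  (Proof adapted from `…RTBottomRungTransverseSocket`,
gk2-p3 g24; the regular frame is that of `F` itself.) [cite: McCallumLMS1991, §4 Prop. 4.4 (1), §5 proof of Prop. 5.2 (13)]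
[cite: Howard2004HeegnerKolyvagin, Lemma 2.7.3] [cite: GrossLMS1991, §3 (3.1)–(3.3), §9] -/
theorem hTr_of_three_le_transposition (hK : IsImaginaryQuadratic K) (hodd : Odd (NumberField.discr K)) (h3 : NumberField.discr K ≠ -3)
    (Dt : ModularParametrizationData W (W.conductorNorm ℤ)) (β : ℤ) (ι : K →+* ℂ)
    [∀ j : ℕ, NumberField (ringClassField K ι j)] {L : ℕ} (hL : 3 ≤ L) :
    ∀ (n' : ℕ) (d' : KolyvaginHeegnerData Dt β ι n') (Z : galoisCohomology (W.torsionGaloisModule ((2 ^ 2 : ℕ) : ℤ)) 1),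
      Squarefree n' →
      (∀ q ∈ n'.primeFactors, Zhang2014.IsKolyvaginPrime (W.conductorNorm ℤ) W K 2 q ∧ 2 ≤ Zhang2014.kolyvaginIndex W 2 q ∧
        ∃ (v₁ : HeightOneSpectrum (𝓞 ℚ)) (𝔓 : Ideal (absIntegers (𝓞 ℚ) ℚ)) (h : absoluteGaloisGroup ℚ),
          (q : 𝓞 ℚ) ∈ v₁.asIdeal ∧ 𝔓 ∈ v₁.primesAbove ∧ IsArithFrobAt (𝓞 ℚ) h 𝔓 ∧ ∃ u : geomTorsion W 2, h • u ≠ u) →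
      resTorsion W K ((2 ^ 2 : ℕ) : ℤ) Z = d'.kolyvaginClass Nat.prime_two 2 →
      ∀ (v : HeightOneSpectrum (𝓞 ℚ)) (ℓ : ℕ), ℓ ∈ n'.primeFactors → (ℓ : 𝓞 ℚ) ∈ v.asIdeal →
        L ≤ Zhang2014.kolyvaginIndex W 2 ℓ →
        (∃ (v₁ : HeightOneSpectrum (𝓞 ℚ)) (𝔓 : Ideal (absIntegers (𝓞 ℚ) ℚ)) (h : absoluteGaloisGroup ℚ),
          (ℓ : 𝓞 ℚ) ∈ v₁.asIdeal ∧ 𝔓 ∈ v₁.primesAbove ∧ IsArithFrobAt (𝓞 ℚ) h 𝔓 ∧ ∃ u : geomTorsion W 2, h • u ≠ u) →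
        ∀ 𝔓 ∈ v.primesAbove, ∀ F : absoluteGaloisGroup ℚ, IsArithFrobAt (𝓞 ℚ) F 𝔓 →
          ∃ P₁ : geomTorsion W ((2 ^ 2 : ℕ) : ℤ), h1Eval W _ ((2 : ℕ) • Z) F = F • P₁ - P₁ := by
  -- (adapted from gk2-p3 g24's `hTr_of_three_le`, `…RTBottomRungTransverseSocket`, with `c₀ := F`)
  intro n' d' Z hn' hn'K hZ v ℓ hℓ hℓv hLℓ hR 𝔓 h𝔓 F hF
  have h2K : Module.finrank ℚ K = 2 := hK.1
  have hD : NumberField.discr K < -4 := IsImaginaryQuadratic.discr_lt_neg_four_of_odd hK hodd h3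
  have hKol := (hn'K ℓ hℓ).1
  -- `F` is a regular involution of `E[4]`: `F² = 1` and `F` moves a point of `E[2]` (gk2-p2's transport of the transposition clause)
  obtain ⟨hFF, hmv⟩ := PlusDescent.frob_involutive_and_moves_twoTorsion_of_transposition W K (M := 2) (by norm_num) hKol
    (le_trans (by omega) hLℓ) hR hℓv h𝔓 hF
  -- the regular frame of `F` on `E[4]` (crux-23716 engine)
  obtain ⟨P₀, -, hgen, hfree⟩ :=
    OffBigImageOddLocalAtTwo.Engine.exists_regular_generator_of_smul_twoTorsion_ne W F hmv (M := 2) (by norm_num)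
  have hfree4 : ∀ a b : ℤ, a • P₀ + b • F • P₀ = 0 → (4 : ℤ) ∣ a ∧ (4 : ℤ) ∣ b := fun a b h ↦ by
    have h' := hfree a b h
    norm_num at h'
    exact h'
  refine RelaxedCount.exists_h1Eval_two_nsmul_eq_smul_sub_of_sq (fun _ ↦ rfl) hFF hgen hfree4 Z ?_
  -- `τ ∈ Γ_K` over `F·F`, fixing `E_K[4]`
  obtain ⟨θ, hθQ, hθ⟩ := exists_sq_eq_discr_not_mem_range K h2K
  have hθ' : θ ∉ (algebraMap ℚ K).range := fun h ↦ hθQ (RingHom.mem_range.mp h)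
  obtain ⟨τ, hτF⟩ := SelmerDescent.sq_mem_range_absGaloisRestrict_of_sq_eq h2K hθ' hθ F
  have hτF' : absGaloisRestrict ℚ K τ = F * F := hτF
  have hτF'' : resGal (K := ℚ) K τ = F * F := hτF
  have hτT : τ ∈ torsionFixing (W.baseChange K) ((2 ^ 2 : ℕ) : ℤ) := by
    rw [mem_torsionFixing_iff]
    intro Q
    obtain ⟨P, rfl⟩ := (torsionBaseChangeMap_bijective K W ((2 ^ 2 : ℕ) : ℤ)).2 Q
    rw [← torsionBaseChangeMap_smul, hτF'', mul_smul, hFF]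
  refine RelaxedCount.two_zsmul_h1Eval_sq_eq_zero_of_resTorsion Z hτF'' hτT ?_
  rw [hZ, h1Eval_kolyvaginClass_eq_zero_of_absGaloisRestrict_eq_sq W hK hD Dt β ι 2 hn'
    (fun q hq ↦ ⟨(hn'K q hq).1, (hn'K q hq).2.1⟩) d' hℓ (by omega) hℓv h𝔓 hF hτF' hτT, smul_zero]

end Socket

end Summit.BirchSwinnertonDyer.BirchSwinnertonDyer.Theorems.GenusExact.TransverseValue

end
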